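import Mathlib.Algebra.BigOperators.Fin
import Mathlib.Algebra.Group.Pi.Lemmas
import Mathlib.Algebra.Order.BigOperators.Ring.Finset
import Mathlib.Data.Fintype.BigOperators
import Mathlib.Data.Fintype.Pi
import Mathlib.Data.Real.Basic
import Mathlib.Tactic.FieldSimp
import Mathlib.Tactic.Positivity
import Mathlib.Tactic.Ring
import Mathlib.Tactic.GCongr
import Mathlib.Tactic.Linarith
import Mathlib.Tactic.NormNum
import HarnessLib

/-!
# Random power products in a finite abelian group are nearly uniform

Let `G` be a finite abelian group, `g₁, …, gₘ ∈ G` elements generating `G` (every `f ∈ G` is a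
product `∏ gᵢ^{eᵢ}`), and `d ≥ 1` a common exponent (`gᵢ^d = 1`; e.g. `d = #G`). For `b ≥ 1` and
`f ∈ G` let `N(f)` be the number of exponent vectors `r ∈ {0, …, b-1}^m` with `∏ gᵢ^{rᵢ} = f`.
Then (`card_mul_card_filter_prod_pow_bounds`)

  `(⌊b/d⌋ d)^m ≤ #G · N(f) ≤ ((⌊b/d⌋ + 1) d)^m`,

so `N(f) = (b^m / #G) e^{ε}` with `(1 - d/b)^m ≤ e^{ε} ≤ (1 + d/b)^m`
(`card_filter_prod_pow_div_bounds`): random exponents in a range `b ≫ m d` give nearly uniformly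
distributed elements of `G`. This is Lemma 5.1 / Theorem 5.2 of Lenstra–Pomerance, *A rigorous
time bound for factoring integers*, J. Amer. Math. Soc. **5** (1992) 497–498 (there for the class
group `C_Δ`, `d = #C_Δ`, `b = |Δ|`, exponents in `{1, …, b}`, and with the finer error
`min{h-1, m(d-1)}/(b-d+1)` taken from Lenstra, *Algorithms in algebraic number theory*, Bull. AMS 26
(1992), Lemma 4.1), the step "given generators of `C_Δ` one can draw random elements of `C_Δ` with
an approximately uniform distribution" of the class group relations method; the same lemma serves
every generic class-group / finite-abelian-group algorithm (Hafner–McCurley, Buchmann).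
Exponents in `{1, …, b}` instead of `{0, …, b-1}` change `N(f)` into `N(f · (∏ gᵢ)⁻¹)`, to which
the same bounds apply.

Proof: `r ↦ (r / d, r % d)` (componentwise) is a bijection `{0..qd-1}^m → {0..q-1}^m × {0..d-1}^m`
under which `∏ gᵢ^{rᵢ} = ∏ gᵢ^{rᵢ mod d}`; so on the box `{0, …, qd-1}^m` every `f` is hit exactly
`q^m K(f)` times, `K(f) = #{s ∈ {0..d-1}^m : ∏ gᵢ^{sᵢ} = f}`; all `K(f)` are equal (translate by
a preimage of `f`) and sum to `d^m`, so `#G · K(f) = d^m`; finally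
`{0..qd-1}^m ⊆ {0..b-1}^m ⊆ {0..(q+1)d-1}^m` for `q = ⌊b/d⌋`. Everything is proved.

## References

* H. W. Lenstra Jr., C. Pomerance, *A rigorous time bound for factoring integers*, J. Amer. Math.
  Soc. 5 (1992) 483–516, §5, Lemma 5.1 and Theorem 5.2. [LenstraPomerance1992]
* H. W. Lenstra Jr., *Algorithms in algebraic number theory*, Bull. Amer. Math. Soc. 26 (1992)
  211–244, Lemma 4.1.
-/

namespace Literature.GroupTheory.FiniteAbelian

open Finset

variable {G : Type*} [CommGroup G] {m : ℕ}

/-! ### Power products only depend on the exponents modulo a common exponent -/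

/-- If `gᵢ ^ d = 1` for all `i` then `∏ gᵢ ^ (rᵢ % d) = ∏ gᵢ ^ rᵢ`. [folklore] -/
theorem prod_pow_mod_eq {g : Fin m → G} {d : ℕ} (hgd : ∀ i, g i ^ d = 1) (r : Fin m → ℕ) :
    ∏ i, g i ^ (r i % d) = ∏ i, g i ^ r i :=
  Finset.prod_congr rfl fun i _ => (pow_eq_pow_mod (r i) (hgd i)).symm

/-- Translating the exponents: if `∏ gᵢ^{eᵢ} = f` with `eᵢ ≤ d`, `gᵢ^d = 1`, then
`(∏ gᵢ ^ (sᵢ + (d - eᵢ))) · f = ∏ gᵢ ^ sᵢ`. [folklore] -/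
theorem prod_pow_add_sub_mul {g : Fin m → G} {d : ℕ} (hgd : ∀ i, g i ^ d = 1) {e : Fin m → ℕ}
    (he : ∀ i, e i ≤ d) {f : G} (hef : ∏ i, g i ^ e i = f) (s : Fin m → ℕ) :
    (∏ i, g i ^ (s i + (d - e i))) * f = ∏ i, g i ^ s i := by
  rw [← hef, ← Finset.prod_mul_distrib]
  refine Finset.prod_congr rfl fun i _ => ?_
  rw [← pow_add, show s i + (d - e i) + e i = s i + d by have := he i; omega, pow_add, hgd i,
    mul_one]

/-! ### The count on a box of side `q d` -/

section count

variable [DecidableEq G]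

/-- On the box `{0, …, qd-1}^m` every `f` is hit exactly `q^m · K(f)` times, where
`K(f) = #{s ∈ {0, …, d-1}^m : ∏ gᵢ^{sᵢ} = f}`: the bijection `r ↦ (r / d, r % d)`.
[cite: LenstraPomerance1992, §5 proof of Lemma 5.1] -/
theorem card_filter_box_eq {g : Fin m → G} {d : ℕ} (hd : 0 < d) (hgd : ∀ i, g i ^ d = 1)
    (q : ℕ) (f : G) :
    #{r ∈ Fintype.piFinset fun _ : Fin m => range (q * d) | ∏ i, g i ^ r i = f} =
      q ^ m * #{s ∈ Fintype.piFinset fun _ : Fin m => range d | ∏ i, g i ^ s i = f} := by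
  have key : #{r ∈ Fintype.piFinset fun _ : Fin m => range (q * d) | ∏ i, g i ^ r i = f} =
      #{p ∈ (Fintype.piFinset fun _ : Fin m => range q) ×ˢ
          (Fintype.piFinset fun _ : Fin m => range d) | ∏ i, g i ^ p.2 i = f} := by
    refine card_bij' (fun r _ => (fun i => r i / d, fun i => r i % d))
      (fun p _ => fun i => d * p.1 i + p.2 i) ?_ ?_ ?_ ?_
    · intro r hr
      rw [mem_filter, Fintype.mem_piFinset] at hr
      rw [mem_filter, mem_product, Fintype.mem_piFinset, Fintype.mem_piFinset]
      refine ⟨⟨fun i => mem_range.2 ?_, fun i => mem_range.2 (Nat.mod_lt _ hd)⟩, ?_⟩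
      · exact Nat.div_lt_of_lt_mul (by rw [mul_comm]; exact mem_range.1 (hr.1 i))
      · show ∏ i, g i ^ (r i % d) = f
        rw [prod_pow_mod_eq hgd]
        exact hr.2
    · intro p hp
      rw [mem_filter, mem_product, Fintype.mem_piFinset, Fintype.mem_piFinset] at hp
      rw [mem_filter, Fintype.mem_piFinset]
      refine ⟨fun i => mem_range.2 ?_, ?_⟩
      · have h1 := mem_range.1 (hp.1.1 i)
        have h2 := mem_range.1 (hp.1.2 i)
        calc d * p.1 i + p.2 i < d * p.1 i + d := by omega
          _ = d * (p.1 i + 1) := by ring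
          _ ≤ d * q := Nat.mul_le_mul_left d h1
          _ = q * d := mul_comm _ _
      · show ∏ i, g i ^ (d * p.1 i + p.2 i) = f
        rw [← prod_pow_mod_eq hgd]
        have : ∀ i, (d * p.1 i + p.2 i) % d = p.2 i := fun i => by
          rw [Nat.mul_add_mod, Nat.mod_eq_of_lt (mem_range.1 (hp.1.2 i))]
        simp_rw [this]
        exact hp.2
    · intro r _
      funext i
      exact Nat.div_add_mod (r i) d
    · intro p hp
      rw [mem_filter, mem_product, Fintype.mem_piFinset, Fintype.mem_piFinset] at hp
      have h2 : ∀ i, p.2 i < d := fun i => mem_range.1 (hp.1.2 i)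
      refine Prod.ext ?_ ?_
      · funext i
        show (d * p.1 i + p.2 i) / d = p.1 i
        rw [Nat.mul_add_div hd, Nat.div_eq_of_lt (h2 i), add_zero]
      · funext i
        show (d * p.1 i + p.2 i) % d = p.2 i
        rw [Nat.mul_add_mod, Nat.mod_eq_of_lt (h2 i)]
  rw [key, filter_product_right (fun s : Fin m → ℕ => ∏ i, g i ^ s i = f), card_product,
    Fintype.card_piFinset, prod_const, card_univ, Fintype.card_fin, card_range]

/-- All fibres of `s ↦ ∏ gᵢ^{sᵢ}` on `{0, …, d-1}^m` have the same size, when the `gᵢ` generate `G`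
and `gᵢ^d = 1`: translate by a preimage of `f`. [cite: LenstraPomerance1992, §5 proof of Thm 5.2] -/
theorem card_filter_cube_eq_card_filter_cube_one {g : Fin m → G} {d : ℕ} (hd : 0 < d)
    (hgd : ∀ i, g i ^ d = 1) (hsurj : ∀ f : G, ∃ e : Fin m → ℕ, ∏ i, g i ^ e i = f) (f : G) :
    #{s ∈ Fintype.piFinset fun _ : Fin m => range d | ∏ i, g i ^ s i = f} =
      #{s ∈ Fintype.piFinset fun _ : Fin m => range d | ∏ i, g i ^ s i = 1} := by
  obtain ⟨e₀, he₀⟩ := hsurj f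
  set e : Fin m → ℕ := fun i => e₀ i % d with he_def
  have he : ∀ i, e i ≤ d := fun i => (Nat.mod_lt _ hd).le
  have hef : ∏ i, g i ^ e i = f := by rw [he_def]; simp only; rw [prod_pow_mod_eq hgd, he₀]
  refine card_bij' (fun s _ => fun i => (s i + (d - e i)) % d) (fun t _ => fun i => (t i + e i) % d)
    ?_ ?_ ?_ ?_
  · intro s hs
    rw [mem_filter, Fintype.mem_piFinset] at hs ⊢
    refine ⟨fun i => mem_range.2 (Nat.mod_lt _ hd), ?_⟩
    rw [prod_pow_mod_eq hgd]
    have h := prod_pow_add_sub_mul hgd he hef s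
    rw [hs.2] at h
    exact mul_eq_right.1 h
  · intro t ht
    rw [mem_filter, Fintype.mem_piFinset] at ht ⊢
    refine ⟨fun i => mem_range.2 (Nat.mod_lt _ hd), ?_⟩
    rw [prod_pow_mod_eq hgd]
    have : ∏ i, g i ^ (t i + e i) = (∏ i, g i ^ t i) * ∏ i, g i ^ e i := by
      rw [← Finset.prod_mul_distrib]
      exact Finset.prod_congr rfl fun i _ => pow_add _ _ _
    rw [this, ht.2, hef, one_mul]
  · intro s hs
    rw [mem_filter, Fintype.mem_piFinset] at hs
    funext i
    have h1 := mem_range.1 (hs.1 i)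
    show ((s i + (d - e i)) % d + e i) % d = s i
    rw [Nat.mod_add_mod, show s i + (d - e i) + e i = s i + d by have := he i; omega,
      Nat.add_mod_right, Nat.mod_eq_of_lt h1]
  · intro t ht
    rw [mem_filter, Fintype.mem_piFinset] at ht
    funext i
    have h1 := mem_range.1 (ht.1 i)
    show ((t i + e i) % d + (d - e i)) % d = t i
    rw [Nat.mod_add_mod, show t i + e i + (d - e i) = t i + d by have := he i; omega,
      Nat.add_mod_right, Nat.mod_eq_of_lt h1]

/-- `#G · K(f) = d^m` for every `f`: the fibres of `s ↦ ∏ gᵢ^{sᵢ}` on `{0, …, d-1}^m` are equal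
and partition the cube. [cite: LenstraPomerance1992, §5 proof of Thm 5.2] -/
theorem card_mul_card_filter_cube_eq [Fintype G] {g : Fin m → G} {d : ℕ} (hd : 0 < d)
    (hgd : ∀ i, g i ^ d = 1) (hsurj : ∀ f : G, ∃ e : Fin m → ℕ, ∏ i, g i ^ e i = f) (f : G) :
    Fintype.card G * #{s ∈ Fintype.piFinset fun _ : Fin m => range d | ∏ i, g i ^ s i = f} =
      d ^ m := by
  have hsum := card_eq_sum_card_fiberwise (s := Fintype.piFinset fun _ : Fin m => range d)
    (t := (univ : Finset G)) (f := fun s => ∏ i, g i ^ s i) (fun _ _ => mem_univ _)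
  rw [Fintype.card_piFinset, prod_const, card_univ, Fintype.card_fin, card_range] at hsum
  rw [hsum, sum_congr rfl fun f' _ => card_filter_cube_eq_card_filter_cube_one hd hgd hsurj f',
    sum_const, card_univ, smul_eq_mul, card_filter_cube_eq_card_filter_cube_one hd hgd hsurj f]

/-! ### The bounds -/

/-- **Random power products are nearly uniform** [LP92, Lemma 5.1 / Thm 5.2]. Let `G` be a finite
abelian group, `g : Fin m → G` with every element of `G` of the form `∏ gᵢ^{eᵢ}`, `d ≥ 1` with
`gᵢ^d = 1`, and `b` a natural number. Then the number `N(f)` of `r ∈ {0, …, b-1}^m` with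
`∏ gᵢ^{rᵢ} = f` satisfies `(⌊b/d⌋ d)^m ≤ #G · N(f) ≤ ((⌊b/d⌋ + 1) d)^m`.
[cite: LenstraPomerance1992, §5 Lemma 5.1 and Thm 5.2] -/
theorem card_mul_card_filter_prod_pow_bounds [Fintype G] {g : Fin m → G} {d : ℕ} (hd : 0 < d)
    (hgd : ∀ i, g i ^ d = 1) (hsurj : ∀ f : G, ∃ e : Fin m → ℕ, ∏ i, g i ^ e i = f) (b : ℕ)
    (f : G) :
    (b / d * d) ^ m ≤
        Fintype.card G * #{r ∈ Fintype.piFinset fun _ : Fin m => range b | ∏ i, g i ^ r i = f} ∧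
      Fintype.card G * #{r ∈ Fintype.piFinset fun _ : Fin m => range b | ∏ i, g i ^ r i = f} ≤
        ((b / d + 1) * d) ^ m := by
  set q := b / d with hq
  have hK := card_mul_card_filter_cube_eq hd hgd hsurj f
  have hmono : ∀ {b₁ b₂ : ℕ}, b₁ ≤ b₂ →
      #{r ∈ Fintype.piFinset fun _ : Fin m => range b₁ | ∏ i, g i ^ r i = f} ≤
        #{r ∈ Fintype.piFinset fun _ : Fin m => range b₂ | ∏ i, g i ^ r i = f} := by
    intro b₁ b₂ h
    exact card_le_card (filter_subset_filter _
      (Fintype.piFinset_subset _ _ fun _ => range_subset_range.2 h))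
  have hlow : q * d ≤ b := Nat.div_mul_le_self b d
  have hupp : b ≤ (q + 1) * d := by
    have := Nat.lt_div_mul_add (a := b) hd
    rw [← hq] at this
    nlinarith
  constructor
  · calc (q * d) ^ m = q ^ m * d ^ m := mul_pow _ _ _
      _ = Fintype.card G *
          #{r ∈ Fintype.piFinset fun _ : Fin m => range (q * d) | ∏ i, g i ^ r i = f} := by
            rw [card_filter_box_eq hd hgd, ← hK]; ring
      _ ≤ _ := Nat.mul_le_mul_left _ (hmono hlow)
  · calc Fintype.card G * #{r ∈ Fintype.piFinset fun _ : Fin m => range b | ∏ i, g i ^ r i = f}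
        ≤ Fintype.card G *
          #{r ∈ Fintype.piFinset fun _ : Fin m => range ((q + 1) * d) | ∏ i, g i ^ r i = f} :=
            Nat.mul_le_mul_left _ (hmono hupp)
      _ = (q + 1) ^ m * d ^ m := by rw [card_filter_box_eq hd hgd, ← hK]; ring
      _ = ((q + 1) * d) ^ m := (mul_pow _ _ _).symm

/-- The same in the form `N(f) = (b^m/#G) e^{ε}`, `(1 - d/b)^m ≤ e^{ε} ≤ (1 + d/b)^m`: for `b ≥ 1`,
`(1 - d/b)^m ≤ #G · N(f) / b^m ≤ (1 + d/b)^m` (real numbers; for `d ≤ b` the lower bound is the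
useful one, `≥ 1 - m d / b`). [cite: LenstraPomerance1992, §5 Lemma 5.1 and Thm 5.2] -/
theorem card_filter_prod_pow_div_bounds [Fintype G] {g : Fin m → G} {d b : ℕ} (hd : 0 < d)
    (hdb : d ≤ b) (hgd : ∀ i, g i ^ d = 1) (hsurj : ∀ f : G, ∃ e : Fin m → ℕ, ∏ i, g i ^ e i = f)
    (f : G) :
    (1 - (d : ℝ) / b) ^ m ≤ Fintype.card G *
        #{r ∈ Fintype.piFinset fun _ : Fin m => range b | ∏ i, g i ^ r i = f} / (b : ℝ) ^ m ∧
      Fintype.card G *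
        #{r ∈ Fintype.piFinset fun _ : Fin m => range b | ∏ i, g i ^ r i = f} / (b : ℝ) ^ m ≤
        (1 + (d : ℝ) / b) ^ m := by
  obtain ⟨h1, h2⟩ := card_mul_card_filter_prod_pow_bounds hd hgd hsurj b f
  have hb : (0 : ℝ) < b := by exact_mod_cast hd.trans_le hdb
  have hbm : (0 : ℝ) < (b : ℝ) ^ m := pow_pos hb m
  have hlow : ((b : ℝ) - d) ≤ ((b / d * d : ℕ) : ℝ) := by
    have : b < b / d * d + d := by
      have := Nat.lt_div_mul_add (a := b) hd
      linarith
    have h' : ((b : ℕ) : ℝ) < ((b / d * d + d : ℕ) : ℝ) := by exact_mod_cast this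
    push_cast at h' ⊢
    linarith
  have hupp : (((b / d + 1) * d : ℕ) : ℝ) ≤ (b : ℝ) + d := by
    have : (b / d + 1) * d ≤ b + d := by
      have := Nat.div_mul_le_self b d
      nlinarith
    exact_mod_cast this
  have hbd : (0 : ℝ) ≤ (b : ℝ) - d := by
    have : ((d : ℕ) : ℝ) ≤ b := by exact_mod_cast hdb
    linarith
  constructor
  · rw [le_div_iff₀ hbm]
    have e1 : (1 - (d : ℝ) / b) ^ m * (b : ℝ) ^ m = ((b : ℝ) - d) ^ m := by
      rw [← mul_pow]; congr 1; field_simp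
    rw [e1]
    calc ((b : ℝ) - d) ^ m ≤ (((b / d * d : ℕ) : ℝ)) ^ m := pow_le_pow_left₀ hbd hlow m
      _ ≤ _ := by exact_mod_cast h1
  · rw [div_le_iff₀ hbm]
    have e2 : (1 + (d : ℝ) / b) ^ m * (b : ℝ) ^ m = ((b : ℝ) + d) ^ m := by
      rw [← mul_pow]; congr 1; field_simp
    rw [e2]
    calc (Fintype.card G : ℝ) *
          #{r ∈ Fintype.piFinset fun _ : Fin m => range b | ∏ i, g i ^ r i = f}
        ≤ ((((b / d + 1) * d : ℕ) : ℝ)) ^ m := by exact_mod_cast h2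
      _ ≤ ((b : ℝ) + d) ^ m := pow_le_pow_left₀ (by positivity) hupp m

end count

end Literature.GroupTheory.FiniteAbelian
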